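import Summits.QuantumAdvantage.QuantumAdvantage.Theses.OddPrimeWalk
import Summits.QuantumAdvantage.AdviceFreeQNC0.WalkHardFGap
import HarnessLib

/-!
# Route OddPrimeWalk, item `SparseOdd` (stmt-QuantumAdvantage-22732): rung R4 for every prime `p ≥ 5`

The route's aside `SparseOdd` — `∀ p ≥ 5 prime, WalkHardFSparse p` (strategies of `𝔽_p`-degree `(log₂ n)^C` with `s`
potentially-active cuts, `s³(log₂ n)^{2C+3} ≤ n`, ANY geometry, win α's u-walk game on at most `θ·2ⁿ` inputs) — is the tree
theorem `Summit.QuantumAdvantage.AdviceFreeQNC0.walkHardFSparse (p) (hp3 : p ≠ 3)` (`AdviceFreeQNC0/WalkHardFGap.lean`: R3 on the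
longest cut-free interval, `sparseOfGap`) at `p ≥ 5`.  WHAT THIS IS NOT: the dense residual `DenseResidualOdd` is open.
-/

set_option linter.dupNamespace false

namespace Summit.QuantumAdvantage.QuantumAdvantage.Theorems

/-- **Item `SparseOdd` — PROVED**: `∀ p ≥ 5 prime, WalkHardFSparse p` (one line over `AdviceFreeQNC0.walkHardFSparse`). -/
theorem oddPrimeWalk_sparseOdd : Summit.QuantumAdvantage.QuantumAdvantage.Theses.OddPrimeWalk.SparseOdd :=
  fun p _ hp => Summit.QuantumAdvantage.AdviceFreeQNC0.walkHardFSparse p (by omega)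

end Summit.QuantumAdvantage.QuantumAdvantage.Theorems
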